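import Summits.NavierStokesRegularity.NavierStokesRegularity.Theorems.AdaptedFrequencyConverges.Negative.FalseWithoutDecay

/-!
# The `tauberian-omega-limit` stubs without the far-field hypotheses

Negative-side support for crux `AdaptedFrequencyConverges` (stmt-NavierStokesRegularity-10493, route
`AdaptedFrequency`), drefute seat on the picked line `tauberian-omega-limit`
(`Cruxes/AdaptedFrequencyConverges/Lines/tauberian-omega-limit.lean`, stubs `stub_kernelCalculus`,
`stub_pinching`, `stub_slowDecrease`, `stub_landau`).

HYPOTHESIS MUTATION, kernel-checked on the cdisprove witness of `…Negative.FalseWithoutDecay` (the exact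
linear Navier–Stokes flow `vel`/`pres` with its exact anisotropic Gaussian adapted kernel `G ν`, adapted
enstrophy `ω(t)² = amp t ^ 2`, adapted frequency `2 cos log(1−t)`):

* `stub_pinching_false_without_decay` — the two-sided pinching stub is FALSE once the three far-field
  fields of the line's `Setting` (Leray–Hopf class, `HasRapidSpatialDecay (u 0)`, and the sup over all `x`
  in `IsTypeIBlowup`, the latter weakened to the parabolic-local Type-I bound) are dropped: on the witness
  `(1−t)² H(t) = (1−t)² ω(t)² → 0` (`tendsto_sq_mul_adaptedEnstrophy_vel`), so no `c₀ > 0` exists.  Only the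
  LOWER half fails: the upper half `(1−t)² H ≤ e²` holds there (`sq_mul_adaptedEnstrophy_vel_le`), and so does
  the differentiability asserted by `stub_kernelCalculus` — indeed its full conclusion, formula included
  (`stub_kernelCalculus_on_witness`, `kernelCalculus_rhs_vel`) — those are local.
* `stub_slowDecrease_false_without_decay` — the hardest stub (slow decrease of `Λ` over dyadic log-time
  windows, the skeleton's `SlowlyDecreasingAt (adaptedFrequency u G T) T`, written INLINE) is FALSE without the
  same far-field fields: `Λ = 2cos log(1−t)` drops from `2` (at `1 − t = e^{−2πn}`) to `2cos log 2 < 1.55` at the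
  dyadic endpoint `1 − t' = e^{−2πn}/2`, for every `n`, violating slow decrease with `ε = 1/4`.

CONSEQUENCE for the lead: any proof of `stub_slowDecrease` and of the lower bound in `stub_pinching` must use
finite energy / decay / the global sup-norm Type-I bound in a way that fails for linear flows (same load-bearing
fields as the crux itself, `adaptedFrequencyConverges_false_without_decay`); `stub_kernelCalculus` and the upper
pinching carry no far-field content.
-/

noncomputable section

namespace Summit.NavierStokesRegularity.NavierStokesRegularity.Theorems.AdaptedFrequencyConverges.Negative

open scoped Topology InnerProductSpace RealInnerProductSpace
open Literature.Analysis.FluidPDE Set Filter MeasureTheory Real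

/-- On the linear witness the adapted enstrophy against its exact kernel is `ω(t)²`. [folklore] -/
theorem adaptedEnstrophy_vel {ν : ℝ} (hν : 0 < ν) {t : ℝ} (ht : t < 1) :
    adaptedEnstrophy vel (G ν) t = amp t ^ 2 :=
  integral_curl_vel_sq_mul_G hν ht

/-- On the linear witness the adapted frequency with terminal time `T = 1` is `2 cos log (1 − t)`. [folklore] -/
theorem adaptedFrequency_vel {ν : ℝ} (hν : 0 < ν) {t : ℝ} (ht : t < 1) :
    adaptedFrequency vel (G ν) 1 t = 2 * Real.cos (Real.log (1 - t)) :=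
  frequency_eq hν (H := adaptedEnstrophy vel (G ν)) (Λ := adaptedFrequency vel (G ν) 1) rfl rfl ht

/-- `ω(t)² ≤ e²`. [folklore] -/
theorem amp_sq_le (t : ℝ) : amp t ^ 2 ≤ Real.exp 2 :=
  calc amp t ^ 2 ≤ Real.exp 1 ^ 2 := pow_le_pow_left₀ (amp_pos t).le (amp_le t) 2
    _ = Real.exp 2 := by rw [← Real.exp_nat_mul]; norm_num

/-- The differentiability asserted by `stub_kernelCalculus` holds on the witness (a LOCAL statement):
`H′(t) = 2ω(t)·ω′(t)`, `ω′ = ω·d`. [folklore] -/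
theorem hasDerivAt_adaptedEnstrophy_vel {ν : ℝ} (hν : 0 < ν) {t : ℝ} (ht : t < 1) :
    HasDerivAt (adaptedEnstrophy vel (G ν)) (2 * amp t * (amp t * str t)) t := by
  have hHeq : (fun s => amp s ^ 2) =ᶠ[𝓝 t] adaptedEnstrophy vel (G ν) := by
    filter_upwards [Iio_mem_nhds ht] with s hs
    exact (adaptedEnstrophy_vel hν hs).symm
  have h2 : HasDerivAt (fun s => amp s ^ 2) (((2 : ℕ) : ℝ) * amp t ^ (2 - 1) * (amp t * str t)) t :=
    (hasDerivAt_amp ht).pow 2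
  have h3 : HasDerivAt (fun s => amp s ^ 2) (2 * amp t * (amp t * str t)) t := by
    convert h2 using 1; norm_num
  exact h3.congr_of_eventuallyEq hHeq.symm

/-- **Bench check of the `stub_kernelCalculus` formula.**  On the witness the right-hand side of the stub,
`2∫⟪ω, (∇u)ω⟫G − 2ν∫|∇ω|²G`, evaluates to `2ω(t)²d(t)` (`∇ω = 0`, `⟪e₀, D₀e₀⟫ = 1`, `⟪e₀, Je₀⟫ = 0`,
`∫G = 1`) — the same value as `H′ = 2ω ω′`, `ω′ = ωd`: signs, the factor `2` and the placement of `ω` in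
`fderiv ℝ (u t) x (curl (u t) x) = (ω·∇)u` are consistent. [folklore] -/
theorem kernelCalculus_rhs_vel {ν : ℝ} (hν : 0 < ν) {t : ℝ} (ht : t < 1) :
    2 * (∫ x, ⟪curl (vel t) x, fderiv ℝ (vel t) x (curl (vel t) x)⟫ * G ν t x) -
      2 * ν * (∫ x, frobeniusNormSq (fderiv ℝ (curl (vel t)) x) * G ν t x) =
      2 * amp t * (amp t * str t) := by
  have hvel : vel t = linVel (str t) (amp t) := rfl
  have hcurl : curl (vel t) = fun _ => EuclideanSpace.single 0 (amp t) := by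
    funext x; rw [hvel, curl_linVel]
  have hinner : ∀ x, ⟪curl (vel t) x, fderiv ℝ (vel t) x (curl (vel t) x)⟫ = str t * amp t ^ 2 := by
    intro x
    rw [hvel, curl_linVel, fderiv_linVel, EuclideanSpace.inner_single_left]
    simp
    ring
  have hfd : ∀ x, fderiv ℝ (curl (vel t)) x = 0 := by
    intro x; rw [hcurl]; simp
  simp_rw [hinner, hfd, frobeniusNormSq_zero, zero_mul, integral_zero, mul_zero, sub_zero]
  rw [MeasureTheory.integral_const_mul, integral_G hν ht]
  ring

/-- **`stub_kernelCalculus` holds on the witness** (its conclusion is a LOCAL statement, true without any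
far-field input): `H = adaptedEnstrophy vel (G ν)` has the derivative given by the stub's formula at every
`t < 1`. [folklore] -/
theorem stub_kernelCalculus_on_witness {ν : ℝ} (hν : 0 < ν) {t : ℝ} (ht : t < 1) :
    HasDerivAt (adaptedEnstrophy vel (G ν))
      (2 * (∫ x, ⟪curl (vel t) x, fderiv ℝ (vel t) x (curl (vel t) x)⟫ * G ν t x) -
        2 * ν * (∫ x, frobeniusNormSq (fderiv ℝ (curl (vel t)) x) * G ν t x)) t := by
  rw [kernelCalculus_rhs_vel hν ht]
  exact hasDerivAt_adaptedEnstrophy_vel hν ht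

/-- The UPPER pinching holds on the witness without any far-field input: `(1−t)² H(t) ≤ e²` on `[0,1)`. [folklore] -/
theorem sq_mul_adaptedEnstrophy_vel_le {ν : ℝ} (hν : 0 < ν) {t : ℝ} (ht : t ∈ Ico (0:ℝ) 1) :
    (1 - t) ^ 2 * adaptedEnstrophy vel (G ν) t ≤ Real.exp 2 := by
  rw [adaptedEnstrophy_vel hν ht.2]
  have h0 : 0 ≤ 1 - t := by linarith [ht.2]
  have h1 : (1 - t) ^ 2 ≤ 1 := by nlinarith [ht.1]
  calc (1 - t) ^ 2 * amp t ^ 2 ≤ 1 * Real.exp 2 :=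
        mul_le_mul h1 (amp_sq_le t) (sq_nonneg _) zero_le_one
    _ = Real.exp 2 := one_mul _

/-- The LOWER pinching fails on the witness: `(1−t)² H(t) → 0` as `t ↑ 1`. [folklore] -/
theorem tendsto_sq_mul_adaptedEnstrophy_vel {ν : ℝ} (hν : 0 < ν) :
    Tendsto (fun t => (1 - t) ^ 2 * adaptedEnstrophy vel (G ν) t) (𝓝[<] 1) (𝓝 0) := by
  have h0 : Tendsto (fun t : ℝ => (1 - t) ^ 2 * Real.exp 2) (𝓝[<] 1) (𝓝 0) := by
    have hc : Continuous (fun t : ℝ => (1 - t) ^ 2 * Real.exp 2) := by fun_prop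
    have := hc.tendsto 1
    simp only [sub_self, ne_eq, OfNat.ofNat_ne_zero, not_false_eq_true, zero_pow, zero_mul] at this
    exact this.mono_left nhdsWithin_le_nhds
  refine tendsto_of_tendsto_of_tendsto_of_le_of_le' tendsto_const_nhds h0 ?_ ?_
  · filter_upwards [self_mem_nhdsWithin] with t ht
    rw [adaptedEnstrophy_vel hν ht]; positivity
  · filter_upwards [self_mem_nhdsWithin] with t ht
    rw [adaptedEnstrophy_vel hν ht]
    exact mul_le_mul_of_nonneg_left (amp_sq_le t) (sq_nonneg _)

/-- **`stub_pinching` is false without the far-field hypotheses.**  The negated statement is the line's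
`stub_pinching` with its bundle `Setting` opened up and the three far-field fields removed (`lerayHopf`,
`decay`) resp. weakened (`typeI` ↦ parabolic-local Type-I bound at `(T,x₀)`); all local fields kept
(`0 < ν`, `0 < T`, classical NS on `Ico 0 T`, `t₀ ∈ Ico 0 T`, backward singularity, adapted kernel,
Gaussian comparability).  Witness: `ν = T = 1`, `x₀ = 0`, `t₀ = 0`, `vel`/`pres`/`G 1`, where
`(1−t)² H = (1−t)² ω(t)² ≤ (1−t)² e² < c₀` close to `t = 1`. [folklore] -/
theorem stub_pinching_false_without_decay :
    ¬ (∀ (ν T : ℝ) (u : ℝ → E3 → E3) (p : ℝ → E3 → ℝ) (x₀ : E3) (t₀ : ℝ) (K : ℝ → E3 → ℝ),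
        0 < ν → 0 < T → IsClassicalNSSolutionOn (Ico 0 T) ν 0 u p → t₀ ∈ Ico 0 T →
        (∃ C : ℝ, ∀ᶠ t in 𝓝[<] T, ∀ x, ‖x - x₀‖ ^ 2 ≤ T - t → ‖u t x‖ ≤ C / Real.sqrt (T - t)) →
        (∀ r : ℝ, 0 < r →
          eLpNorm (Function.uncurry u) ⊤ (volume.restrict (parabolicCylinder r (T, x₀))) = ⊤) →
        IsAdaptedBackwardKernel ν u (Ico t₀ T) T x₀ K → IsGaussianComparable K (Ico t₀ T) T x₀ →
        ∃ t₁ ∈ Ico t₀ T, ∃ c₀ C₁ : ℝ, 0 < c₀ ∧ ∀ t ∈ Ico t₁ T,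
          c₀ ≤ (T - t) ^ 2 * adaptedEnstrophy u K t ∧ (T - t) ^ 2 * adaptedEnstrophy u K t ≤ C₁) := by
  intro h
  have h1 : (0:ℝ) < 1 := one_pos
  obtain ⟨t₁, ht₁, c₀, C₁, hc₀, hpin⟩ := h 1 1 vel pres 0 0 (G 1) h1 h1
    (isClassicalNSSolutionOn_vel 1) ⟨le_rfl, h1⟩ local_typeI_vel singular_vel
    (isAdaptedBackwardKernel_iff.2 (kernel_clauses h1))
    (isGaussianComparable_iff_fin_three.2 (G_comparable h1))
  -- a time `1 - δ ∈ [t₁, 1)` so close to `1` that `δ² e² < c₀`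
  set δ : ℝ := min (1 - t₁) (c₀ / (2 * Real.exp 2)) with hδ
  have he : 0 < Real.exp 2 := Real.exp_pos 2
  have hδpos : 0 < δ := lt_min (by linarith [ht₁.2]) (by positivity)
  have hδ1 : δ ≤ 1 - t₁ := min_le_left _ _
  have hδ2 : δ ≤ c₀ / (2 * Real.exp 2) := min_le_right _ _
  have hδle1 : δ ≤ 1 := hδ1.trans (by linarith [ht₁.1])
  have ht : 1 - δ ∈ Ico t₁ 1 := ⟨by linarith, by linarith⟩
  have hlow := (hpin (1 - δ) ht).1
  rw [adaptedEnstrophy_vel h1 ht.2, sub_sub_cancel] at hlow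
  have hbound : δ ^ 2 * amp (1 - δ) ^ 2 ≤ c₀ / 2 :=
    calc δ ^ 2 * amp (1 - δ) ^ 2 ≤ δ ^ 2 * Real.exp 2 :=
          mul_le_mul_of_nonneg_left (amp_sq_le _) (sq_nonneg _)
      _ ≤ δ * Real.exp 2 := by
          apply mul_le_mul_of_nonneg_right _ he.le
          nlinarith
      _ ≤ c₀ / (2 * Real.exp 2) * Real.exp 2 := mul_le_mul_of_nonneg_right hδ2 he.le
      _ = c₀ / 2 := by field_simp
  linarith

/-- **`stub_slowDecrease` is false without the far-field hypotheses.**  The negated statement is the line's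
hardest stub `Setting … → SlowlyDecreasingAt (adaptedFrequency u G T) T` with `SlowlyDecreasingAt` written
INLINE (`∀ ε > 0, ∃ t₁ < T, ∀ t t', t₁ ≤ t → t ≤ t' → t' < T → T − t ≤ 2 (T − t') → Λ t ≤ Λ t' + ε`,
verbatim from the skeleton) and `Setting` opened up with the far-field fields removed / weakened exactly as
in `stub_pinching_false_without_decay`.  Witness: the same flow; `Λ = 2 cos log (1 − t)` equals `2` at
`t = 1 − e^{−2πn}` and `2 cos log 2 ≤ 1.55` at the dyadic endpoint `t' = 1 − e^{−2πn}/2`, for all `n`, so the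
drop over one dyadic window never falls below `0.45 > ε = 1/4`. [folklore] -/
theorem stub_slowDecrease_false_without_decay :
    ¬ (∀ (ν T : ℝ) (u : ℝ → E3 → E3) (p : ℝ → E3 → ℝ) (x₀ : E3) (t₀ : ℝ) (K : ℝ → E3 → ℝ),
        0 < ν → 0 < T → IsClassicalNSSolutionOn (Ico 0 T) ν 0 u p → t₀ ∈ Ico 0 T →
        (∃ C : ℝ, ∀ᶠ t in 𝓝[<] T, ∀ x, ‖x - x₀‖ ^ 2 ≤ T - t → ‖u t x‖ ≤ C / Real.sqrt (T - t)) →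
        (∀ r : ℝ, 0 < r →
          eLpNorm (Function.uncurry u) ⊤ (volume.restrict (parabolicCylinder r (T, x₀))) = ⊤) →
        IsAdaptedBackwardKernel ν u (Ico t₀ T) T x₀ K → IsGaussianComparable K (Ico t₀ T) T x₀ →
        ∀ ε > 0, ∃ t₁ < T, ∀ t t' : ℝ, t₁ ≤ t → t ≤ t' → t' < T → T - t ≤ 2 * (T - t') →
          adaptedFrequency u K T t ≤ adaptedFrequency u K T t' + ε) := by
  intro h
  have h1 : (0:ℝ) < 1 := one_pos
  obtain ⟨t₁, ht₁, hsd⟩ := h 1 1 vel pres 0 0 (G 1) h1 h1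
    (isClassicalNSSolutionOn_vel 1) ⟨le_rfl, h1⟩ local_typeI_vel singular_vel
    (isAdaptedBackwardKernel_iff.2 (kernel_clauses h1))
    (isGaussianComparable_iff_fin_three.2 (G_comparable h1)) (1 / 4) (by norm_num)
  -- a period index `n` with `e^{-2πn} < 1 - t₁`
  have hlim : Tendsto (fun n : ℕ => Real.exp (-((n : ℝ) * (2 * π)))) atTop (𝓝 0) :=
    Real.tendsto_exp_neg_atTop_nhds_zero.comp
      (tendsto_natCast_atTop_atTop.atTop_mul_const (show (0:ℝ) < 2 * π by positivity))
  obtain ⟨n, hn⟩ := (hlim.eventually (gt_mem_nhds (sub_pos.2 ht₁))).exists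
  set e : ℝ := Real.exp (-((n : ℝ) * (2 * π))) with he_def
  have he : 0 < e := Real.exp_pos _
  have hn' : e < 1 - t₁ := hn
  have he2 : Real.exp (-(Real.log 2 + (n : ℝ) * (2 * π))) = e / 2 := by
    rw [neg_add, Real.exp_add, Real.exp_neg (Real.log 2), Real.exp_log two_pos, he_def]; ring
  have key := hsd (1 - e) (1 - e / 2) (by linarith) (by linarith) (by linarith) (by linarith)
  rw [adaptedFrequency_vel h1 (show 1 - e < 1 by linarith),
    adaptedFrequency_vel h1 (show 1 - e / 2 < 1 by linarith), sub_sub_cancel, sub_sub_cancel] at key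
  have hlog1 : Real.log e = -((n : ℝ) * (2 * π)) := by rw [he_def, Real.log_exp]
  have hlog2 : Real.log (e / 2) = -(Real.log 2 + (n : ℝ) * (2 * π)) := by rw [← he2, Real.log_exp]
  rw [hlog1, hlog2, Real.cos_neg, Real.cos_neg, Real.cos_nat_mul_two_pi,
    Real.cos_add_nat_mul_two_pi] at key
  -- numerics: cos (log 2) ≤ 0.7726
  have hL1 := Real.log_two_gt_d9
  have hL2 := Real.log_two_lt_d9
  have hLpos : 0 < Real.log 2 := by linarith
  have habs : |Real.log 2| ≤ 1 := by rw [abs_of_pos hLpos]; linarith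
  have hb := Real.cos_bound habs
  rw [abs_of_pos hLpos] at hb
  have hb' := (abs_le.1 hb).2
  have hsq : Real.log 2 ^ 2 < 0.4806 := by nlinarith
  have hsq' : 0.48 < Real.log 2 ^ 2 := by nlinarith
  have h4 : Real.log 2 ^ 4 < 0.231 := by
    have : Real.log 2 ^ 4 = (Real.log 2 ^ 2) ^ 2 := by ring
    rw [this]; nlinarith
  have hcos : Real.cos (Real.log 2) ≤ 0.7726 := by nlinarith
  linarith

end Summit.NavierStokesRegularity.NavierStokesRegularity.Theorems.AdaptedFrequencyConverges.Negative

end
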